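import Summits.RiemannHypothesis.RiemannHypothesis.Theses.WeilComb
import Literature.NumberTheory.LFunctions.WeilExplicit
import Literature.NumberTheory.LFunctions.WeilMellinBounds
import Literature.NumberTheory.LFunctions.WeilArchimedeanMoments
import Literature.NumberTheory.LFunctions.WeilArchimedeanPositivityProofs
import Literature.NumberTheory.LFunctions.RiemannSiegelStirling
import Literature.Analysis.SpecialFunctions.DigammaVerticalSeries

/-!
# Stub `stub_archBathtub` of line `Sketch` for crux `WeilComb.CombShapePositivity`
(item stmt-RiemannHypothesis-11229, route route-RiemannHypothesis-WeilComb)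

The support-free "bathtub" lower bound for the archimedean diagonal of a Weil test `g`: with
`L = ‖g‖₁ = ∫ ‖g‖` (`weilNorm1`), `N = ‖g‖₂² = ∫ ‖g‖²` (`weilNorm2Sq`), `0 < L` and `2L² ≤ πN`,

`Re W_∞(g ⋆ g̃) ≥ N (log(N/(2L²)) − 1) − (21/(5π)) L²`.

Proof.
* `Re W_∞(g ⋆ g̃) = (1/2π) ∫ G ρ − N log π` with `G(u) = |ĝ(1/2 + iu)|²`, `ρ(u) = Re ψ(1/4 + iu/2)`
  (`weilArchIntegral_weilConv_weilReflect`, `weilConv_weilReflect_apply_zero`).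
* Bathtub (`bathtub_archBathtub`): `0 ≤ G ≤ L²` (`norm_weilMellin_half_line_le`), `∫ G = 2πN`
  (`integral_norm_sq_weilMellin_half_line`); with `T = πN/L²` (so `L² · 2T = ∫ G`) the weight
  `ρ` is even and increasing in `|u|` (`reDigammaQuarter_mono`), hence pointwise
  `(G − L² 1_{(−T,T]})(ρ − ρ(T)) ≥ 0`, and integrating, `∫ G ρ ≥ L² ∫_{−T}^{T} ρ`.
* Stirling (`integral_reDigammaQuarter_ge_archBathtub`): `∫_{−T}^{T} ρ = 4 · argGammaVert ¼ (T/2)`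
  (evenness and `u = 2v`), and the tree's explicit Stirling formula for `arg Γ` on `Re s = ¼`
  (`abs_argGammaVert_sub_stirling_le`, `stirlingArgConst_one_quarter`: `c(¼) = −π/8`) gives, for
  `T ≥ 2`, `∫_{−T}^{T} ρ ≥ 2T(log(T/2) − 1) − π/2 − 4K(¼) ≥ 2T(log(T/2) − 1) − 42/5`
  (`4K(¼) = π/3 + 31/24`, `π ≤ 4`).
* Assembly: `(1/2π) L² (2T(log(T/2) − 1) − 42/5) − N log π = N(log(N/(2L²)) − 1) − (21/(5π)) L²`
  since `L² T = πN`.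
-/

noncomputable section

-- the sub-problem path RiemannHypothesis/RiemannHypothesis duplicates a namespace (D-0017)
set_option linter.dupNamespace false

open scoped BigOperators ComplexConjugate
open Complex MeasureTheory Set

namespace Summit.RiemannHypothesis.RiemannHypothesis.Theorems.WeilCombBohrFejer

open Literature.NumberTheory.LFunctions
open Literature.Analysis.SpecialFunctions (reDigammaQuarter reDigammaQuarter_even
  reDigammaQuarter_mono continuous_reDigammaQuarter)

/-! ### The digamma integral `∫_{-T}^{T} Re ψ(1/4 + iu/2) du` via Stirling for `arg Γ` -/

/-- `∫_{-T}^{T} Re ψ(1/4 + iu/2) du = 4 · argGammaVert ¼ (T/2)`: the weight is even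
(`reDigammaQuarter_even`) and `u = 2v` (`argGammaVert ¼ τ = ∫₀^τ Re ψ(¼ + iv) dv`). [folklore] -/
private theorem integral_reDigammaQuarter_eq_archBathtub (T : ℝ) :
    ∫ u in (-T)..T, reDigammaQuarter u = 4 * argGammaVert (1 / 4) (T / 2) := by
  have hc : Continuous reDigammaQuarter := continuous_reDigammaQuarter
  have h1 : ∫ u in (-T)..0, reDigammaQuarter u = ∫ u in (0 : ℝ)..T, reDigammaQuarter u := by
    have h := intervalIntegral.integral_comp_neg reDigammaQuarter (a := 0) (b := T)
    simp only [neg_zero, reDigammaQuarter_even] at h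
    exact h.symm
  set F : ℝ → ℝ := fun v ↦ (digamma (((1 / 4 : ℝ) : ℂ) + v * I)).re with hFdef
  have hF : ∀ u : ℝ, reDigammaQuarter u = F (u / 2) := fun u ↦ by
    simp only [hFdef, reDigammaQuarter]
    push_cast
    ring_nf
  have h2 : ∫ u in (0 : ℝ)..T, reDigammaQuarter u = 2 * argGammaVert (1 / 4) (T / 2) := by
    calc ∫ u in (0 : ℝ)..T, reDigammaQuarter u = ∫ u in (0 : ℝ)..T, F (u / 2) :=
          intervalIntegral.integral_congr fun u _ ↦ hF u
      _ = 2 * ∫ v in (0 : ℝ) / 2..T / 2, F v := by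
          rw [intervalIntegral.integral_comp_div F two_ne_zero, smul_eq_mul]
      _ = 2 * argGammaVert (1 / 4) (T / 2) := by
          rw [zero_div, hFdef, argGammaVert]
  rw [← intervalIntegral.integral_add_adjacent_intervals (hc.intervalIntegrable (-T) 0)
    (hc.intervalIntegrable 0 T), h1, h2]
  ring

/-- For `T ≥ 2`: `∫_{-T}^{T} Re ψ(1/4 + iu/2) du ≥ 2T (log(T/2) − 1) − 42/5`, from the explicit
Stirling formula `|arg Γ(¼ + iτ) − (τ log τ − τ) + π/8| ≤ K(¼)/τ` (`τ = T/2 ≥ 1`,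
`abs_argGammaVert_sub_stirling_le`, `stirlingArgConst_one_quarter`) and
`π/2 + 4K(¼) = 5π/6 + 31/24 ≤ 42/5`. [folklore] -/
private theorem integral_reDigammaQuarter_ge_archBathtub {T : ℝ} (hT : 2 ≤ T) :
    2 * T * (Real.log (T / 2) - 1) - 42 / 5 ≤ ∫ u in (-T)..T, reDigammaQuarter u := by
  rw [integral_reDigammaQuarter_eq_archBathtub]
  have hτ : 1 ≤ T / 2 := by linarith
  have h := abs_argGammaVert_sub_stirling_le (σ := 1 / 4) (by norm_num) hτ
  rw [stirlingArgConst_one_quarter] at h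
  have hK : stirlingVertRate (1 / 4) = 1 / 6 + Real.pi / 12 + 1 / 32 + 1 / 8 := by
    rw [stirlingVertRate]; norm_num
  have hK0 : 0 ≤ stirlingVertRate (1 / 4) := by rw [hK]; positivity
  have hKτ : stirlingVertRate (1 / 4) / (T / 2) ≤ stirlingVertRate (1 / 4) :=
    div_le_self hK0 hτ
  have h' := (abs_le.1 h).1
  have hpi := Real.pi_le_four
  have hpi0 := Real.pi_pos
  linarith

/-! ### The bathtub rearrangement -/

/-- **Bathtub rearrangement.** For a Weil test `g` with `L = ‖g‖₁`, `N = ‖g‖₂²` and `T ≥ 0` with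
`L² T = πN`: `L² ∫_{-T}^{T} ρ ≤ ∫ |ĝ(1/2+iu)|² ρ(u) du` (`ρ(u) = Re ψ(1/4 + iu/2)`). Indeed
`0 ≤ G ≤ L²` (`norm_weilMellin_half_line_le`), `∫ G = 2πN = L² · 2T` (Plancherel), and `ρ` is
increasing in `|u|` (`reDigammaQuarter_mono`), so `(G − L² 1_{(−T,T]})(ρ − ρ(T)) ≥ 0` pointwise;
integrate. [folklore] -/
private theorem bathtub_archBathtub {g : ℝ → ℂ} (hg : IsWeilTest g) {T : ℝ} (hT0 : 0 ≤ T)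
    (hT : weilNorm1 g ^ 2 * T = Real.pi * weilNorm2Sq g) :
    weilNorm1 g ^ 2 * ∫ u in (-T)..T, reDigammaQuarter u ≤
      ∫ u : ℝ, ‖weilMellin g (1 / 2 + u * I)‖ ^ 2 * reDigammaQuarter u := by
  set L := weilNorm1 g with hL
  set N := weilNorm2Sq g with hN
  set G : ℝ → ℝ := fun u ↦ ‖weilMellin g (1 / 2 + u * I)‖ ^ 2 with hG
  set ρ : ℝ → ℝ := reDigammaQuarter with hρ
  have hGi : Integrable G := integrable_norm_sq_weilMellin_half_line hg
  have hPl : ∫ u, G u = 2 * Real.pi * N := integral_norm_sq_weilMellin_half_line hg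
  have hGL : ∀ u, G u ≤ L ^ 2 := fun u ↦
    pow_le_pow_left₀ (norm_nonneg _) (norm_weilMellin_half_line_le hg u) 2
  have hG0 : ∀ u, 0 ≤ G u := fun u ↦ by positivity
  have hGρi : Integrable fun u ↦ G u * ρ u :=
    integrable_norm_sq_weilMellin_mul_reDigammaQuarter hg
  have hc : Continuous ρ := continuous_reDigammaQuarter
  have hTT : -T ≤ T := by linarith
  -- the comparison function `h = 1_{(−T,T]} L² (ρ − ρ(T)) + ρ(T) G`
  set k : ℝ → ℝ := (Ioc (-T) T).indicator (fun u ↦ L ^ 2 * (ρ u - ρ T)) with hk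
  set h : ℝ → ℝ := fun u ↦ k u + ρ T * G u with hh
  have hki' : IntervalIntegrable (fun u ↦ L ^ 2 * (ρ u - ρ T)) volume (-T) T :=
    (continuous_const.mul (hc.sub continuous_const)).intervalIntegrable _ _
  have hki : Integrable k := hki'.1.integrable_indicator measurableSet_Ioc
  have hkval : ∫ u, k u = L ^ 2 * ((∫ u in (-T)..T, ρ u) - 2 * T * ρ T) := by
    rw [hk, integral_indicator measurableSet_Ioc, ← intervalIntegral.integral_of_le hTT,
      intervalIntegral.integral_const_mul, intervalIntegral.integral_sub (hc.intervalIntegrable _ _)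
        intervalIntegrable_const, intervalIntegral.integral_const, smul_eq_mul]
    ring
  have hhi : Integrable h := hki.add (hGi.const_mul _)
  have hhval : ∫ u, h u = L ^ 2 * ∫ u in (-T)..T, ρ u := by
    rw [hh, integral_add hki (hGi.const_mul _), integral_const_mul, hkval, hPl]
    have e : L ^ 2 * (2 * T * ρ T) = ρ T * (2 * Real.pi * N) := by
      linear_combination (2 * ρ T) * hT
    linarith
  -- pointwise `h ≤ G ρ`
  have hpt : ∀ u, h u ≤ G u * ρ u := by
    intro u
    by_cases hu : u ∈ Ioc (-T) T
    · have hku : k u = L ^ 2 * (ρ u - ρ T) := by rw [hk]; exact indicator_of_mem hu _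
      have hρu : ρ u ≤ ρ T := reDigammaQuarter_mono (abs_le_abs hu.2 (by linarith [hu.1]))
      have hprod : 0 ≤ (L ^ 2 - G u) * (ρ T - ρ u) :=
        mul_nonneg (sub_nonneg.2 (hGL u)) (sub_nonneg.2 hρu)
      rw [hh]
      dsimp only
      rw [hku]
      linarith
    · have hku : k u = 0 := by rw [hk]; exact indicator_of_notMem hu _
      have hTu : |T| ≤ |u| := by
        rw [abs_of_nonneg hT0]
        simp only [mem_Ioc, not_and_or, not_lt, not_le] at hu
        rcases hu with h1 | h1
        · linarith [neg_abs_le u]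
        · linarith [le_abs_self u]
      have hρu : ρ T ≤ ρ u := reDigammaQuarter_mono hTu
      have hprod : ρ T * G u ≤ ρ u * G u := mul_le_mul_of_nonneg_right hρu (hG0 u)
      rw [hh]
      dsimp only
      rw [hku, zero_add, mul_comm (G u)]
      exact hprod
  have hmono : ∫ u, h u ≤ ∫ u, G u * ρ u := integral_mono hhi hGρi hpt
  rwa [hhval] at hmono

/-! ### The stub -/

/-- **Stub S3 — bathtub bound for the archimedean diagonal of a Weil test.** For a Weil test `g`
with `0 < ‖g‖₁` and `2‖g‖₁² ≤ π‖g‖₂²`: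
`Re W_∞(g ⋆ g̃) ≥ ‖g‖₂² (log(‖g‖₂²/(2‖g‖₁²)) − 1) − (21/(5π)) ‖g‖₁²`
(`Re W_∞(g ⋆ g̃) = (1/2π) ∫ G ρ − ‖g‖₂² log π`, the bathtub rearrangement
`∫ G ρ ≥ ‖g‖₁² ∫_{−T}^{T} ρ` at `T = π‖g‖₂²/‖g‖₁² ≥ 2`, and Stirling's formula for
`∫_{−T}^{T} ρ = 4 arg Γ(¼ + iT/4)`). -/
theorem stub_archBathtub : ∀ g : ℝ → ℂ, IsWeilTest g → 0 < weilNorm1 g →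
    2 * weilNorm1 g ^ 2 ≤ Real.pi * weilNorm2Sq g →
    weilNorm2Sq g * (Real.log (weilNorm2Sq g / (2 * weilNorm1 g ^ 2)) - 1) -
        21 / (5 * Real.pi) * weilNorm1 g ^ 2 ≤
      (weilArchTerm (weilConv g (weilReflect g))).re := by
  intro g hg hL hcond
  set N := weilNorm2Sq g with hN
  set L := weilNorm1 g with hL'
  have hπ : 0 < Real.pi := Real.pi_pos
  have hL2 : 0 < L ^ 2 := by positivity
  have hN0 : 0 < N := pos_of_mul_pos_right (by linarith : 0 < Real.pi * N) hπ.le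
  set T : ℝ := Real.pi * N / L ^ 2 with hT
  have hLT : L ^ 2 * T = Real.pi * N := by rw [hT]; field_simp
  have hT2 : 2 ≤ T := by rw [hT, le_div_iff₀ hL2]; linarith
  set A : ℝ := ∫ t : ℝ, ‖weilMellin g (1 / 2 + t * I)‖ ^ 2 *
    (Complex.digamma (1 / 4 + t / 2 * I)).re with hA
  -- Step 1: the archimedean term of `g ⋆ g̃` is `(1/2π) A − N log π`
  -- adapted from Theorems/WeilCombCombShapePositivitySharpArchDiag.lean
  have harch : (weilArchTerm (weilConv g (weilReflect g))).re =
      1 / (2 * Real.pi) * A - N * Real.log Real.pi := by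
    have e : weilArchTerm (weilConv g (weilReflect g)) =
        ((1 / (2 * Real.pi) * A - N * Real.log Real.pi : ℝ) : ℂ) := by
      unfold weilArchTerm
      rw [weilArchIntegral_weilConv_weilReflect hg, weilConv_weilReflect_apply_zero, ← hA,
        show (∫ t : ℝ, ‖g t‖ ^ 2) = N from rfl]
      push_cast
      ring
    rw [e, Complex.ofReal_re]
  -- Step 2: bathtub `L² ∫_{-T}^{T} ρ ≤ A`
  have hAρ : A = ∫ u : ℝ, ‖weilMellin g (1 / 2 + u * I)‖ ^ 2 * reDigammaQuarter u := rfl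
  have hbath : L ^ 2 * ∫ u in (-T)..T, reDigammaQuarter u ≤ A := by
    rw [hAρ]
    exact bathtub_archBathtub hg (by linarith) hLT
  -- Step 3: Stirling `∫_{-T}^{T} ρ ≥ 2T(log(T/2) − 1) − 42/5`
  have hstir := integral_reDigammaQuarter_ge_archBathtub hT2
  -- Step 4: assemble
  have hmono : 1 / (2 * Real.pi) * (L ^ 2 * (2 * T * (Real.log (T / 2) - 1) - 42 / 5)) ≤
      1 / (2 * Real.pi) * A := by
    refine mul_le_mul_of_nonneg_left ?_ (by positivity)
    exact (mul_le_mul_of_nonneg_left hstir hL2.le).trans hbath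
  have hq : 0 < N / (2 * L ^ 2) := by positivity
  have hlog : Real.log (T / 2) = Real.log Real.pi + Real.log (N / (2 * L ^ 2)) := by
    rw [← Real.log_mul hπ.ne' hq.ne']
    congr 1
    rw [hT]
    field_simp
  have key : 1 / (2 * Real.pi) * (L ^ 2 * (2 * T * (Real.log (T / 2) - 1) - 42 / 5)) =
      N * (Real.log (N / (2 * L ^ 2)) - 1) + N * Real.log Real.pi -
        21 / (5 * Real.pi) * L ^ 2 := by
    have e : L ^ 2 * (2 * T * (Real.log (T / 2) - 1) - 42 / 5) =
        2 * (Real.pi * N) * (Real.log (T / 2) - 1) - 42 / 5 * L ^ 2 := by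
      rw [← hLT]; ring
    rw [e, hlog]
    set ℓ := Real.log (N / (2 * L ^ 2))
    set p := Real.log Real.pi
    field_simp
    ring
  rw [harch]
  linarith [key, hmono]

/-! ### The sharp form of the lower-order term (appended by the lead, cycle c2) -/

/-- For `T ≥ 2`: `∫_{-T}^{T} Re ψ(1/4 + iu/2) du ≥ 2T (log(T/2) − 1) − π/2 − 8K(¼)/T` with
`K(¼) = stirlingVertRate ¼ = 1/6 + π/12 + 5/32`, keeping the `1/T`-decay of the Stirling remainder
(`abs_argGammaVert_sub_stirling_le` at `τ = T/2 ≥ 1`, `stirlingArgConst_one_quarter`). [folklore] -/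
private theorem integral_reDigammaQuarter_ge_sharp_archBathtub {T : ℝ} (hT : 2 ≤ T) :
    2 * T * (Real.log (T / 2) - 1) - Real.pi / 2 - 8 * stirlingVertRate (1 / 4) / T ≤
      ∫ u in (-T)..T, reDigammaQuarter u := by
  rw [integral_reDigammaQuarter_eq_archBathtub]
  have hτ : 1 ≤ T / 2 := by linarith
  have h := abs_argGammaVert_sub_stirling_le (σ := 1 / 4) (by norm_num) hτ
  rw [stirlingArgConst_one_quarter] at h
  have h' := (abs_le.1 h).1
  have e : 8 * stirlingVertRate (1 / 4) / T = 4 * (stirlingVertRate (1 / 4) / (T / 2)) := by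
    field_simp
    ring
  rw [e]
  linarith

/-- **Sharp bathtub bound for the archimedean diagonal of a Weil test.** For a Weil test `g` with
`0 < ‖g‖₁` and `2‖g‖₁² ≤ π‖g‖₂²`:
`Re W_∞(g ⋆ g̃) ≥ ‖g‖₂² (log(‖g‖₂²/(2‖g‖₁²)) − 1) − ‖g‖₁²/4 − (4K(¼)/π²) ‖g‖₁⁴/‖g‖₂²`,
`K(¼) = stirlingVertRate ¼ = 1/6 + π/12 + 5/32 ≈ 0.585` — the same bathtub rearrangement as
`stub_archBathtub`, with the Stirling remainder kept at its true size `O(‖g‖₁⁴/‖g‖₂²)` instead of being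
absorbed into the constant `21/(5π)`; for a narrow bump `g = φ_ε` the lower-order term is
`I₀²/4 + O(ε)` rather than `(21/(5π)) I₀²`. [folklore] -/
theorem re_weilArchTerm_autocorr_ge_bathtubSharp : ∀ g : ℝ → ℂ, IsWeilTest g → 0 < weilNorm1 g →
    2 * weilNorm1 g ^ 2 ≤ Real.pi * weilNorm2Sq g →
    weilNorm2Sq g * (Real.log (weilNorm2Sq g / (2 * weilNorm1 g ^ 2)) - 1) - weilNorm1 g ^ 2 / 4 -
        4 * stirlingVertRate (1 / 4) / Real.pi ^ 2 * (weilNorm1 g ^ 4 / weilNorm2Sq g) ≤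
      (weilArchTerm (weilConv g (weilReflect g))).re := by
  intro g hg hL hcond
  set N := weilNorm2Sq g with hN
  set L := weilNorm1 g with hL'
  have hπ : 0 < Real.pi := Real.pi_pos
  have hL2 : 0 < L ^ 2 := by positivity
  have hN0 : 0 < N := pos_of_mul_pos_right (by linarith : 0 < Real.pi * N) hπ.le
  set T : ℝ := Real.pi * N / L ^ 2 with hT
  have hLT : L ^ 2 * T = Real.pi * N := by rw [hT]; field_simp
  have hT2 : 2 ≤ T := by rw [hT, le_div_iff₀ hL2]; linarith
  have hT0 : 0 < T := by linarith
  set A : ℝ := ∫ t : ℝ, ‖weilMellin g (1 / 2 + t * I)‖ ^ 2 *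
    (Complex.digamma (1 / 4 + t / 2 * I)).re with hA
  -- Step 1: the archimedean term of `g ⋆ g̃` is `(1/2π) A − N log π`
  have harch : (weilArchTerm (weilConv g (weilReflect g))).re =
      1 / (2 * Real.pi) * A - N * Real.log Real.pi := by
    have e : weilArchTerm (weilConv g (weilReflect g)) =
        ((1 / (2 * Real.pi) * A - N * Real.log Real.pi : ℝ) : ℂ) := by
      unfold weilArchTerm
      rw [weilArchIntegral_weilConv_weilReflect hg, weilConv_weilReflect_apply_zero, ← hA,
        show (∫ t : ℝ, ‖g t‖ ^ 2) = N from rfl]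
      push_cast
      ring
    rw [e, Complex.ofReal_re]
  -- Step 2: bathtub `L² ∫_{-T}^{T} ρ ≤ A`
  have hAρ : A = ∫ u : ℝ, ‖weilMellin g (1 / 2 + u * I)‖ ^ 2 * reDigammaQuarter u := rfl
  have hbath : L ^ 2 * ∫ u in (-T)..T, reDigammaQuarter u ≤ A := by
    rw [hAρ]
    exact bathtub_archBathtub hg (by linarith) hLT
  -- Step 3: sharp Stirling
  have hstir := integral_reDigammaQuarter_ge_sharp_archBathtub hT2
  -- Step 4: assemble
  set K : ℝ := stirlingVertRate (1 / 4) with hK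
  have hmono : 1 / (2 * Real.pi) * (L ^ 2 * (2 * T * (Real.log (T / 2) - 1) - Real.pi / 2 - 8 * K / T)) ≤
      1 / (2 * Real.pi) * A := by
    refine mul_le_mul_of_nonneg_left ?_ (by positivity)
    exact (mul_le_mul_of_nonneg_left hstir hL2.le).trans hbath
  have hq : 0 < N / (2 * L ^ 2) := by positivity
  have hlog : Real.log (T / 2) = Real.log Real.pi + Real.log (N / (2 * L ^ 2)) := by
    rw [← Real.log_mul hπ.ne' hq.ne']
    congr 1
    rw [hT]
    field_simp
  have hTinv : 1 / T = L ^ 2 / (Real.pi * N) := by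
    rw [hT]
    field_simp
  have key : 1 / (2 * Real.pi) * (L ^ 2 * (2 * T * (Real.log (T / 2) - 1) - Real.pi / 2 - 8 * K / T)) =
      N * (Real.log (N / (2 * L ^ 2)) - 1) + N * Real.log Real.pi - L ^ 2 / 4 -
        4 * K / Real.pi ^ 2 * (L ^ 4 / N) := by
    have e : L ^ 2 * (2 * T * (Real.log (T / 2) - 1) - Real.pi / 2 - 8 * K / T) =
        2 * (Real.pi * N) * (Real.log (T / 2) - 1) - Real.pi / 2 * L ^ 2 - 8 * K * L ^ 2 * (1 / T) := by
      rw [← hLT]; ring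
    rw [e, hlog, hTinv]
    set ℓ := Real.log (N / (2 * L ^ 2))
    set p := Real.log Real.pi
    field_simp
    ring
  rw [harch]
  linarith [key, hmono]

end Summit.RiemannHypothesis.RiemannHypothesis.Theorems.WeilCombBohrFejer

end
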